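import Summits.QuantumFields.YangMills.Theorems.BalabanUVNodesN27AtAllPinsOfRecord13CoPHVCutBFree
import Summits.QuantumFields.YangMills.Theorems.BalabanUVNodesN19RateEdgeHolderD4AtN16PinnedReadingFSC
import Summits.QuantumFields.YangMills.Theorems.BalabanUVNodesN18PolLimitRateOfGeometricIncrements

/-!
# ★ APWᴮ (dag-n27-c g15, rev 28 recipe (δⱽ)) — storey APW (`…N27AtAllPinsOfRecord13CoPHVCutLinkReading`, p610559) RE-CONCLUDED IN THE (B)-FREE SPINE BODY CURRENCY (FILE 1
# `…N27SpineBodyBFree13CoPH` p624138): the SAME displayed rows (none of them was prefix-keyed), the N19′ face now ⟸ dag-n19-w3's (B)-FREE supplier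
# `forSmallCouplings_h19HolderD4_datumOfRecord₁₃CoPH_of_linkReadingAtN16PinnedReading` (p607220 §1 — the body of their FSC face §2 WITHOUT its two unread binders), composed by FILE 1 §2
# `bodyBFree₁₃CoPH_of_keyedFacesP_bFree`; conclusion = the body at every guarded admissible tuple of `Rg` ⇒ (FILE 1 §2∕§3) the old `Spine (IsRecordOfRecord₁₃CCoPHOn Rg)`, K3⁷'s display AND
# K3⁸'s display `SpineGivenEndpointR13SepCoPHV` AT EVERY VERSION SLOT; `--kind proof --supports stmt-QuantumFields-27366 --as helper`; COUNT-NEUTRAL; ONE theorem, 0 `def`, 0 `sorry`.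
# Below: APW's header VERBATIM for the row-by-row description (read «K3⁷ v5» as «K3⁷ v5 = K3⁸ v6 §0–§2, pins unchanged»).
#
# BalabanUVNodes ∕ N27 = binder B5 AT THE RECORD — storey APW: K3⁷ v5 (941dddb108cbaacf) AT ALL ITS PINS WITH EVERY REMAINING SLOT AT ITS PRODUCER — the four reading pins, the spine pin
# `crOfRecord₁₃VAt K₀ (jc …) sh` read per tuple, the rates' `PHolderD4 β` body from the pins + letter rows + dag-n18-w2's finite-volume kernel door, N20 ∕ N21 keyed witnesses, N27x a theorem, and the
# N19′ CORE EDGE ⟸ dag-n19-w3 g3's N16-PINNED LINK READING `keyedCoreEdgeHolderD4_of_linkReadingAtN16PinnedReading` (`…N19RateEdgeHolderD4AtN16PinnedReadingFSC` p607220) AT THE PINNED SPINE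
# READING — the v5 analogue of BPP `…N27AtBothPinsOfRecord13CoPHVCutProducers` (p598486: v3, two pins, ∀-`g₀`); composed per guarded admissible tuple by dag-n19-w3's FSC composer
# `keyedGuarded₁₃CoPH_of_keyedFacesP_fsc` (p595910 = v5's composition step)
# (cell `pub-ymgap`, HUMAN RULING D-0062 Track A, R134 seat `pub-ymgap-dag-n27-c` (N27 B5 composite, s2) gen 13, HOME trigger (t2⁗) «a producer face in a NEW currency at the pinned reading»:
# dag-n19-w3 g3 FILED-2 l.≈29380; K3⁷ `SpineGivenEndpointR13SepCoPH` = stmt-QuantumFields-20544, `--kind proof --supports 20544 --as helper`; COUNT-NEUTRAL; THEOREMS ONLY, 0 `def`, 0 `sorry`;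
# `N`-generic, `K₀`-generic, regime-generic, NO Theses import, does NOT import the skeleton or its mirror (v5's local `U3PinnedKernels ∕ N15PinnedSized ∕ N16RadiusMatch ∕ PHolderD4 ∕ rrOfRecord ∕
# LiveSel` are SPELLED; `Ne1PinnedOfRecord ∕ N16PinnedLoose ∕ N16LettersEnd` are the tree defs v5 itself imports) — item faces in leaf `…N27SpineGivenEndpointR13SepCoPHAllPinsOfRecordVLinkReading`)

WHAT IS KERNEL-CHECKED ([bookkeeping]; ONE application per regime of the FSC composer at the pinned spine reading: `h20`∕`h21` ⟸ keyed witnesses by dag-n20-d's `relWeightBound_∕shellWeightBound_crOfRecord₁₃VAt`;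
`hrates` ⟸ (Kꜰ) §1 `pHolderD4Body_rateCarriers_of_kernels_pin` per tuple and `g₀` from the rows discharged behind the pins (`n14At_rateCarriersOfRecord₁₃CoPH_of_pinned`,
`n15At_fullGSizedObjects_family`, `rateCarriers_ne3_of_pinnedLoose` + `h16`), the letter rows and `u3KernelInputs_of_finiteVolumeLetters` (`ForSmallCouplings.of_forall` — the pins' rows need no
tuning); `h19` ⟸ dag-n19-w3's ★★★ at `cr :=` the pinned reading; `hx` ⟸ UC §0 `keyedExtraction_crOfRecord₁₃VAt_cut` under `hsel`, `hζm` with (H-U) ∕ `0 ≤ ζ` supplied).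
* §1 ★★★ `spine_rec13CCoPHOn_of_v5pins_linkReading_fsc_at_crOfRecord₁₃VAt_cut` — any regime `Rg`, `hsel` per tuple ⇒ `Spine` at `IsRecordOfRecord₁₃CCoPHOn F N Rg`.  Displayed, and NOTHING
  ELSE: the four pins `hpin1 hpin2 hpinL hpin` · `h16` · `hs hκ hcr hρ` · `hr hinc hS h9 hW` · v5's other two N16 rows `hmatch` (= `N16RadiusMatch ℓ₃ B` spelled) and `hend : N16LettersEnd N g ℓ₃` ·
  `hβ1 : β ≤ 1` · K1⁷'s interval-form window `hβw` · node U3's uniform letters `hunif` · `hsel hζm` · keyed N20 ∕ N21 witnesses `h20 h21` · NODE O's N16-pinned LINK READING `hlink` at the pinned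
  spine reading (dag-n19-w3's hypothesis verbatim, `S :=` the pinned reading's carriers).
* (no live-line edition in this file — the 400-line cap; the leaf instantiates §1 at `Rg := guard ∧ LiveSel`, `hsel := ⟨_, hRg.2⟩` directly.)
Consumed BY NAME: UC p595448 §0; dag-n20-d p590105 ∕ p587226; node00-def-K0c `localBgMeasurable`; dag-n20-w2 `zeta_nonneg_of_provisos₁₃CoPH`; dag-n19-w3 p595910 + p607220 (and through it
`…AtN16PinnedReading`, `…AtTuningWindow`, J's facts); dag-n27-w1 (Kꜰ) §1 p602540; dag-n18-w2 p606911; dag-n14-w1 ∕ dag-n15-a ∕ dag-n16-e pins and faces.  Nothing landed is edited or re-declared.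

HONEST FRAMING.  COMPOSITE-node bookkeeping BY NAME; a REDUCTION, not a discharge; every displayed antecedent is a HYPOTHESIS inhabited for no family today (K0⁷ `Record13SepCoPHInhabited`
OPEN) or a decided MODEL behind a pin (n14-w1's datum-reading tower; dag-n15-a's model-level sized objects); `hlink` is NODE O's world at the runs of record (link-reading ledger, N11's (iii), N14's
positional ∕ dressed rows, the remaining (v′-16)∕(v′-17) rows, the tube bracket) — UNPRINTED content for d = 4, 0 instances; K1⁷'s window `hβw` = `stub_betaWindow13PWS`'s currency (K1⁷ OPEN);
`hunif` a uniform-letters clause on the free `𝔯`; N16 at the loose-data object = THE END's content (hypothesis); the finite-volume kernel letters are Bałaban-type SHAPES NOT PRINTED as such for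
d = 4; NE7b ∕ NE7c witnesses 0∕1 today; `jc sh ℓ s r ℓ₃ g B 𝔯 β ksel` FREE PARAMETERS (no reading minted); nothing of Bałaban's asserted or instantiated; NOT `stub_rates13H` ∕ `stub_expansion13H`;
N14–N22 ∕ N27 NOT discharged (the chair books, R417); K3⁷ OPEN, NOT claimed; skeleton v5 untouched; counts UNMOVED (typed 28∕28 · discharged 5∕27, A 5∕28); one finite four-torus programme at
fixed `ε` — NOT ℝ⁴, NOT infinite volume, NOT OS, NOT a mass gap, NOT Clay.  No decl below carries a cite tag.
-/

set_option autoImplicit false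

namespace Summit.QuantumFields.YangMills.Theorems.BalabanUVNodesN27SpineRecord

open scoped BigOperators Matrix Matrix.Norms.L2Operator
open Finset MeasureTheory
open Literature.MathematicalPhysics.QuantumFieldTheory.Balaban1983to89
open T4OutputRate T4RecentScale T4GoodClassBudget T4CauchySum T4TowerRateComposition T4TowerRateDischarge
open T4EtaRateMin (Readings NE3Shape)
open T4RateLiaison (GaugeDominated)
open FlowStep (RGEqH prefixOf)
open TreeLengthTorus (TFaceConnected torusTreeLen)
open B12TreeDecay (kappa₀)
open Summit.QuantumFields.BalabanUV.T4Continuum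
open AveragingDeficitDualResidual (dualC1 dualC2)
open AveragingDeficitDerivWallProof (wallConst)
open AveragingDeficitPeriodicCounting (IsPeriodicDir)
open MinimalActionSandwich (IsMinimiser minAct)
open MinimalActionRate (sfClass)
open MinimalActionRefine (RegularSup gradConst)
open NE3EnergyShapes (IsUnitarySite IsPeriodicSite)
open NE3.LeafIndexSockets (LeafH3sup)
open Summit.QuantumFields.BalabanUV.T4Continuum.Spine
open Summit.QuantumFields.BalabanUV.T4Continuum.Spine.NE4 (runFlow)
open Summit.QuantumFields.BalabanUV.T4Continuum.NE1p.DressedRoot (DressedTower DressedStabilityStrict)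
open Summit.QuantumFields.YangMills.BalabanUVNodes.N19LedgerLinkSync (LedgerDataSync LedgerAtSync)
open YMDAG.UVSplit
open Summit.QuantumFields.YangMills.BalabanUVNodes.N16HolderDefs (CovRootHolder N16HolderAt)
open Summit.QuantumFields.YangMills.BalabanUVNodes.SpineRatesHolder (RatesHolderAt)
open Literature.MathematicalPhysics.QuantumFieldTheory.Balaban1983to89.T4Continuum (T4Family ULoop)
open Node00 (Stage13HParams datumOfRecord₁₃CoPH SiteSeqKey U3Letters₁₁ NE3Letters₁₁ ne3ConstLayerOfRecord₁₁ ne3NperOfRecord₁₁ ne3DomOfRecord₁₁ ZetaMeasurable ppSelLiveOfRecord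
  EOfRecord₁₃ wOfRecord₉ localBgMeasurable)
open Literature.MathematicalPhysics.QuantumFieldTheory.Balaban1983to89.B12Sec2to5 (betaPrime510)
open Literature.MathematicalPhysics.QuantumFieldTheory.Balaban1983to89.Node00.U3OfKernels (objectsOfRecord₁₃ KernelDecayOfRecord₁₃)
open Literature.MathematicalPhysics.QuantumFieldTheory.Balaban1983to89.Node00.U3KernelLetters (GeometricIncrementsOfRecord₁₃ WindowedNE9OfRecord₁₃ WindowedDecayOfRecord₁₃
  WindowedStepRateOfRecord₁₃)
open Summit.QuantumFields.YangMills.BalabanUVNodes.N16PinnedLayer13CoPH (N16PinnedLoose N16LettersEnd rateCarriers_ne3_of_pinnedLoose)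
open T4WeightBudget (RelWeightBound)
open T4IndicatorShell (ShellWeightBound)
open T4ContinuumYM4Torus (ForSmallCouplings)
open T4ApexHybrid (HybridNE7Under StringwiseHybridNE7)
open Summit.QuantumFields.YangMills.BalabanUVNodes.N19CoreEdgeFSCComposer (keyedGuarded₁₃CoPH_of_keyedFacesP_fsc)
open Summit.QuantumFields.YangMills.BalabanUVNodes.N19RateEdgeHolderD4AtN16PinnedReadingFSC (forSmallCouplings_h19HolderD4_datumOfRecord₁₃CoPH_of_linkReadingAtN16PinnedReading)
open Summit.QuantumFields.YangMills.BalabanUVNodes.SpineCanonicalWeights (core_nonneg_of_shellWeightBound)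
open Summit.QuantumFields.YangMills.BalabanUVNodes.N19TargetClassWeightsE1Keyed
open Summit.QuantumFields.YangMills.BalabanUVNodes.N21KeyedShellWeightShellZero (zeta_nonneg_of_provisos₁₃CoPH)
open YMDAG.N14.TopBorn (Ne1PinnedOfRecord n14At_rateCarriersOfRecord₁₃CoPH_of_pinned)
open Summit.QuantumFields.YangMills.BalabanUVNodes.N15.GenuineRecord (fullGSizedObjects n15At_fullGSizedObjects_family)
open Summit.QuantumFields.YangMills.BalabanUVNodes.N15.AtKeyedHome (neZero_blockFactor)
open YMDAG.N18.PolLimitRate (u3KernelInputs_of_finiteVolumeLetters)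

variable {N : ℕ} [NeZero N] (K₀ : ℕ)
  (jc : (F : T4Family) → (θ : Stage13HParams F N) → θ.Provisos₁₃CoPH F N → (ℕ → ℝ) → List (ULoop F) → ℕ → ℕ)
  (sh : ShellSplit₁₃CoPH N K₀) (β : ℝ) (𝔯 : RateReading₁₃CoPH N)
  (ℓ : (F : T4Family) → Stage13HParams F N → U3Letters₁₁) (s : (F : T4Family) → Stage13HParams F N → ℕ) (r : (F : T4Family) → Stage13HParams F N → ℝ)
  (ℓ₃ : T4Family → NE3Letters₁₁) (g B : T4Family → ℝ)

/-! ## §1 Every v5 slot at its producer, K5 at the per-tuple-cut spine reading of record, N19′ ⟸ the N16-pinned LINK READING at that reading (any regime, `hsel` per tuple) -/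

/-- ★★★ **APWᴮ — THE (B)-FREE SPINE BODY ON A REGIME FROM ALL FOUR PINS WITH EVERY REMAINING SLOT AT ITS PRODUCER** (= APW §1 below, concluded in the body; N19′ ⟸ dag-n19-w3 (B)-free supplier `forSmallCouplings_h19HolderD4_datumOfRecord₁₃CoPH_of_linkReadingAtN16PinnedReading` + `.mono` at the selected run length; FILE 1 §2 composer in place of `keyedGuarded₁₃CoPH_of_keyedFacesP_fsc`).  APW §1 (p610559) description: dag-n19-w3's FSC composer `keyedGuarded₁₃CoPH_of_keyedFacesP_fsc`
(p595910 = v5's composition step) at the PINNED spine reading `fun F θ hP g₀ os ↦ crOfRecord₁₃VAt K₀ (jc F θ hP g₀ os) sh F θ hP g₀ os` with: the rates `P := PHolderD4 β` body supplied per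
tuple by (Kꜰ) §1 `pHolderD4Body_rateCarriers_of_kernels_pin` from the FOUR v5 reading pins (`hpin1 hpin2 hpinL hpin`; rows discharged behind them as in AP §2), `h16`, the U3 letter rows
`hs hκ hcr hρ` and dag-n18-w2's finite-volume door (`hr hinc hS h9 hW` ⇒ `hdec h18 h22`, `u3KernelInputs_of_finiteVolumeLetters`); N20 ∕ N21 from keyed witnesses `h20 h21` by dag-n20-d's
transfers; N27x a THEOREM (UC §0 `keyedExtraction_crOfRecord₁₃VAt_cut` under `hsel`, `hζm`; (H-U) ∕ `0 ≤ ζ` supplied); and the N19′ face ⟸ dag-n19-w3's ★★★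
`keyedCoreEdgeHolderD4_of_linkReadingAtN16PinnedReading` (`…N19RateEdgeHolderD4AtN16PinnedReadingFSC` p607220) AT THIS READING from v5's three N16 rows (`hpinL`, `hmatch` = `N16RadiusMatch ℓ₃ B`
spelled, `hend : N16LettersEnd N g ℓ₃`), `hβ1 : β ≤ 1`, K1⁷'s interval-form window `hβw`, node U3's uniform letters `hunif`, and NODE O's N16-pinned LINK READING `hlink` AT THE PINNED SPINE
READING (dag-n19-w3's displayed hypothesis verbatim with `S := crOfRecord₁₃VAt K₀ (jc …) sh …`; 0 instances in the tree).  So B5 at `IsRecordOfRecord₁₃CCoPHOn F N Rg` costs EXACTLY the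
displayed rows — pins · `h16` · letter rows · finite-volume kernel letters · `hβ1 hmatch hend hβw hunif` · `hsel hζm` · keyed `h20 h21` · `hlink` — and NOTHING parametric is left: every
K4 ∕ K5 slot of v5 is at its producer's deepest landed currency.  Every row a HYPOTHESIS or a decided MODEL (0∕1 today; K0⁷ OPEN); `hlink` = NODE O's world (UNPRINTED content); nothing
of Bałaban's proved; NOT `stub_rates13H` ∕ `stub_expansion13H`; no node discharged. [bookkeeping] -/
theorem bodyBFree₁₃CoPH_of_v5pins_linkReading_at_crOfRecord₁₃VAt_cut (Rg : (F : T4Family) → Stage13HParams F N → Prop)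
    (ksel : (F : T4Family) → (θ : Stage13HParams F N) → θ.Provisos₁₃CoPH F N → (ℕ → ℝ) → List (ULoop F) → ℕ)
    (hpin1 : Ne1PinnedOfRecord 𝔯)
    (hpin2 : ∃ (b aS : ℝ) (ν μ α β' : Fin 4) (c35 p : ℝ), 0 < b ∧ 0 < aS ∧
      ∀ (F : T4Family) (θ : Stage13HParams F N) (hP : θ.Provisos₁₃CoPH F N) (g₀ : ℕ → ℝ) (os : List (ULoop F)) (k : ℕ),
        (𝔯.lit F θ hP g₀ os).ne2 k = haveI := neZero_blockFactor F; fullGSizedObjects 3 F.hL b aS ν μ α β' c35 p)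
    (hpinL : N16PinnedLoose 𝔯 ℓ₃ B)
    (hpin : ∀ (F : T4Family) (θ : Stage13HParams F N) (hP : θ.Provisos₁₃CoPH F N) (g₀ : ℕ → ℝ) (os : List (ULoop F)),
      (𝔯.lit F θ hP g₀ os).u3 = objectsOfRecord₁₃ F N θ.toStage13Params (ℓ F θ))
    (h16 : ∀ (F : T4Family), (∃ θ : Stage13HParams F N, θ.Provisos₁₃CoPH F N ∧ Rg F θ ∧ θ.Admissible F N) →
      N16HolderAt (ne3OfRecord₁₁ F { ne3ConstLayerOfRecord₁₁ F N (ℓ₃ F) with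
        dom := {V | V ∈ ne3DomOfRecord₁₁ F N 0 0 ∧ V ∈ sfClass 4 F.L (ne3NperOfRecord₁₁ F 0 0) ((ℓ₃ F).ε / B F) 0} }) β)
    (hs : ∀ (F : T4Family) (θ : Stage13HParams F N), θ.Provisos₁₃CoPH F N → Rg F θ → θ.Admissible F N → (ℓ F θ).Signs)
    (hκ : ∀ (F : T4Family) (θ : Stage13HParams F N), θ.Provisos₁₃CoPH F N → Rg F θ → θ.Admissible F N → 0 < (ℓ F θ).κ)
    (hcr : ∀ (F : T4Family) (θ : Stage13HParams F N), θ.Provisos₁₃CoPH F N → Rg F θ → θ.Admissible F N →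
      betaPrime510 4 1 (ℓ F θ).κ ≤ (ℓ F θ).cr)
    (hρ : ∀ (F : T4Family) (θ : Stage13HParams F N), θ.Provisos₁₃CoPH F N → Rg F θ → θ.Admissible F N →
      0 ≤ (ℓ F θ).ρ ∧ (ℓ F θ).ρ < 1)
    (hr : ∀ (F : T4Family) (θ : Stage13HParams F N), θ.Provisos₁₃CoPH F N → Rg F θ → θ.Admissible F N → r F θ < 1)
    (hinc : ∀ (F : T4Family) (θ : Stage13HParams F N), θ.Provisos₁₃CoPH F N → Rg F θ → θ.Admissible F N →
      GeometricIncrementsOfRecord₁₃ F N θ.toStage13Params (r F θ))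
    (hS : ∀ (F : T4Family) (θ : Stage13HParams F N), θ.Provisos₁₃CoPH F N → Rg F θ → θ.Admissible F N →
      WindowedStepRateOfRecord₁₃ F N θ.toStage13Params (s F θ) (ℓ F θ).κ (ℓ F θ).θ₅ ((ℓ F θ).C₅ * (ℓ F θ).θ₅))
    (h9 : ∀ (F : T4Family) (θ : Stage13HParams F N), θ.Provisos₁₃CoPH F N → Rg F θ → θ.Admissible F N →
      WindowedNE9OfRecord₁₃ F N θ.toStage13Params (ℓ F θ).κ (ℓ F θ).moduli)
    (hW : ∀ (F : T4Family) (θ : Stage13HParams F N), θ.Provisos₁₃CoPH F N → Rg F θ → θ.Admissible F N →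
      WindowedDecayOfRecord₁₃ F N θ.toStage13Params 0 1 (ℓ F θ).κ)
    (hβ1 : β ≤ 1)
    (hmatch : ∀ F : T4Family, 0 < B F ∧ (ℓ₃ F).ε / B F ≤ (ℓ₃ F).b)
    (hend : N16LettersEnd N g ℓ₃)
    (hβw : ∀ (F : T4Family) (θ : Stage13HParams F N) (hP : θ.Provisos₁₃CoPH F N), Rg F θ → θ.Admissible F N →
      ∃ γ₀ b b' : ℝ, 0 < γ₀ ∧ 0 < b ∧ DagBinding.BetaBoundsInInterval (datumOfRecord₁₃CoPH F N θ hP).C.toB12 γ₀ b b')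
    (hunif : ∀ (F : T4Family) (θ : Stage13HParams F N) (hP : θ.Provisos₁₃CoPH F N), Rg F θ → θ.Admissible F N →
      ∃ M ρ₁ : ℝ, 0 ≤ M ∧ ρ₁ < 1 ∧ ∀ (g₀ : ℕ → ℝ) (os : List (ULoop F)) (k : ℕ), 0 < (rateCarriersOfRecord₁₃CoPH 𝔯 F θ hP g₀ os k).u3.ρ ∧
        (rateCarriersOfRecord₁₃CoPH 𝔯 F θ hP g₀ os k).u3.ρ ≤ ρ₁ ∧
        (rateCarriersOfRecord₁₃CoPH 𝔯 F θ hP g₀ os k).u3.cr * (rateCarriersOfRecord₁₃CoPH 𝔯 F θ hP g₀ os k).u3.C₉ * (rateCarriersOfRecord₁₃CoPH 𝔯 F θ hP g₀ os k).u3.ω ≤ M)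
    (hsel : ∀ (F : T4Family) (θ : Stage13HParams F N), θ.Provisos₁₃CoPH F N → Rg F θ → θ.Admissible F N →
      ∃ E : B12.RunParams → ℝ, θ.ppSel = ppSelLiveOfRecord F N θ.ν θ.τ9 E (wOfRecord₉ F N θ.toStage9Params))
    (hζm : ∀ (F : T4Family) (θ : Stage13HParams F N), θ.Provisos₁₃CoPH F N → Rg F θ → θ.Admissible F N → ZetaMeasurable F N θ.ζ)
    (h20 : ∀ (F : T4Family) (θ : Stage13HParams F N) (hP : θ.Provisos₁₃CoPH F N), Rg F θ → θ.Admissible F N →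
      ∀ (g₀ : ℕ → ℝ) (os : List (ULoop F)),
        ∃ W : ℕ → ℝ, RelWeightBound 1 (classSet₁₃ θ K₀ g₀) (weightA₁₃ θ hP K₀ g₀ os) (weightB₁₃ θ hP K₀ g₀ os) (badClass₁₃ θ K₀ g₀ (jc F θ hP g₀ os)) W)
    (h21 : ∀ (F : T4Family) (θ : Stage13HParams F N) (hP : θ.Provisos₁₃CoPH F N), Rg F θ → θ.Admissible F N →
      ∀ (g₀ : ℕ → ℝ) (os : List (ULoop F)),
        ∃ Wsh : ℕ → ℝ, ShellWeightBound 1 (classSet₁₃ θ K₀ g₀) (weightA₁₃ θ hP K₀ g₀ os) (weightB₁₃ θ hP K₀ g₀ os) (sh F θ hP g₀ os).1 (sh F θ hP g₀ os).2 Wsh)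
    (hlink : ∀ (F : T4Family) (θ : Stage13HParams F N) (hP : θ.Provisos₁₃CoPH F N), Rg F θ → θ.Admissible F N →
      ∀ (γ gIR b : ℝ) (g₀ : ℕ → ℝ), (datumOfRecord₁₃CoPH F N θ hP).Tuned γ gIR g₀ → γ ≤ θ.γ → γ ^ 2 ≤ Real.exp (-1) → 0 < b →
      (∀ K m, 0 ≤ m → m < K → b ≤ (datumOfRecord₁₃CoPH F N θ hP).βfun m (prefixOf (runFlow (datumOfRecord₁₃CoPH F N θ hP) g₀ K) m)) →
      ∀ (os : List (ULoop F)) (k : ℕ),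
        let S : SpineCarriers := crOfRecord₁₃VAt K₀ (jc F θ hP g₀ os) sh F θ hP g₀ os
        let R : RateCarriers N := rateCarriersOfRecord₁₃CoPH 𝔯 F θ hP g₀ os k
        let D : Datum F N := datumOfRecord₁₃CoPH F N θ hP
        letI := S.dec
        ∃ (_ : DecidableEq R.u3.C.Dom) (F' : Type) (ι' X' : Type) (_ : MeasurableSpace ι')
          (L : LedgerDataSync R.u3.C F' ι' S.ι) (Rd : Readings ι' X') (bsel : (ℕ → ℝ) → ℝ) (EB : Functional R.u3.C R.u3.C.BgB)
          (θc θ₃ : ℝ) (g : ℕ → ℕ → ℝ)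
          (uA : ℕ → ι' → R.u3.C.BgA) (uB : ℕ → ι' → R.u3.C.BgB)
          (Pf : ℕ → Params) (d₀ L₀ Koff : ℕ) (cells : (K j : ℕ) → R.u3.C.Dom → Finset (Site (Pf K) j))
          (H033 : Flow → ℕ → Prop) (I : Type) (fam : I → B14.Sect2Data) (Lb βw : ℝ) (κ₁ : ℕ) (Gv Cl : ℝ) (K₁ : ℕ)
          (Λ₀ N₀ : ℝ) (dressed : R.u3.C.Dom → Prop) (_ : DecidablePred dressed)
          (c' t θ γ₃ l₁ : ℝ)
          (sel : ℕ → (B7Prop1Explicit.Site 4 → Fin 4 → (Matrix (Fin N) (Fin N) ℂ)ˣ) → (B7Prop1Explicit.Site 4 → Fin 4 → (Matrix (Fin N) (Fin N) ℂ)ˣ))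
          (rd : ι' → (B7Prop1Explicit.Site 4 → Fin 4 → (Matrix (Fin N) (Fin N) ℂ)ˣ)) (k₀ : ℕ)
          (E₀T κ₁T C₁T : ℝ) (q₁ : ℕ),
          (∀ K i, i ≤ K → g K i = runFlow D g₀ K i) ∧ (∀ K i, K < i → g K i = gIR) ∧
          EB = (fun s => R.u3.EB (bsel s) s) ∧
          (∀ (Sz : ℕ → ℝ → S.ι → ℕ → ℝ) (E₀ : ℝ) (m : ℕ) (a : ℝ) (Cw Λg : ℝ),
            (∀ K t, |t| ≤ S.l₀ → ∀ τ ∈ S.T K \ S.Bad K t, ∀ v ∈ Rd.dom, ∀ j ≤ K,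
              |∑ X ∈ L.fac K t τ with R.u3.C.scale X = j,
                  (Real.log (Real.exp (EB (fun i => g (K + 1) (i + 1)) (uB K v) X
                      - EB (fun i => g (K + 1) (i + 1)) L.oneB X))
                    - Real.log (Real.exp (R.u3.EA (g K) (uA K v) X - R.u3.EA (g K) L.oneA X)))| ≤ Sz K t τ j) →
            0 ≤ E₀ → 0 < a → a < 1 →
            (∀ K t, |t| ≤ S.l₀ → ∀ τ ∈ S.T K \ S.Bad K t, ∀ j ≤ K,
              Sz K t τ j ≤ S.vol * (E₀ * ((K : ℝ) + 1) ^ m * a ^ (K - j))) →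
            (∀ K, Multiplicity (L.All K) R.u3.C.scale (fun X => Real.exp (-(R.u3.κ * R.u3.C.d X))) Cw S.vol Λg K) →
            (∀ K t, |t| ≤ S.l₀ → ∀ τ ∈ S.T K \ S.Bad K t,
              WindowMultiplicity (L.facO K t τ) L.scO L.wO Cw S.vol Λg (jlogOf L.Cl K) K) →
            1 ≤ Λg → L.θ' ≤ Λg →
            LedgerAtSync { L with S := Sz, E₀ := E₀, m := m, a := a, Cw := Cw, Λg := Λg } S.l₀ S.vol S.T S.Bad
              (fun K t τ => S.A K t τ - S.shA K t τ) (fun K t τ => S.B K t τ - S.shB K t τ) Rd R.u3.EA EB R.u3.κ g uA uB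
              R.u3.ω θc R.u3.θ θ₃) ∧
          0 ≤ S.vol ∧
          (∀ K t, |t| ≤ S.l₀ → ∀ τ ∈ S.T K \ S.Bad K t,
            WindowMultiplicity (L.facO K t τ) L.scO L.wO L.Cw S.vol L.Λg (jlogOf L.Cl K) K) ∧
          0 ≤ L.Cw ∧ 1 ≤ L.Λg ∧ L.θ' ≤ L.Λg ∧
          (∀ K, (Pf K).d = d₀) ∧ (∀ K, (Pf K).L = L₀) ∧ (∀ K, (Pf K).K = Koff + K) ∧
          (∀ K, (Fintype.card (Site (Pf K) (Pf K).K) : ℝ) = S.vol) ∧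
          kappa₀ (4 * 2 ^ d₀) (2 * d₀) ≤ R.u3.κ ∧
          (∀ K, ∀ X ∈ L.All K,
            (cells K (R.u3.C.scale X + Koff) X).Nonempty ∧ TFaceConnected (cells K (R.u3.C.scale X + Koff) X)) ∧
          (∀ K j, Set.InjOn (cells K j) ↑((L.All K).filter fun X => R.u3.C.scale X + Koff = j)) ∧
          (∀ K, ∀ X ∈ L.All K, torusTreeLen (cells K (R.u3.C.scale X + Koff) X) ≤ R.u3.C.d X) ∧
          B14.Thm2Printed H033 fam Lb βw κ₁ ∧ βw < 1 ∧ 0 < βw ∧ 1 < Lb ∧ 1 ≤ Gv ∧ 0 ≤ Cl ∧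
          (∀ p K, (R.ne1.𝒯.B p K).PositionalCount fun j k => N₀ * Λ₀ ^ (k - j)) ∧ 0 ≤ N₀ ∧ 0 ≤ Λ₀ ∧ Λ₀ ≤ R.ne1.Λ ∧
          (∀ K t, |t| ≤ S.l₀ → ∀ τ ∈ S.T K \ S.Bad K t, ∀ v ∈ Rd.dom, ∀ j ≤ K, ∃ (i : I) (w : (fam i).Ω) (j' : ℕ),
            (fam i).flow.SatisfiesRG (fam i).K ∧ H033 (fam i).flow (fam i).K ∧ 1 ≤ j' ∧ j' ≤ (fam i).K ∧
            (fam i).K - j' = K - j ∧ (fam i).K ≤ K + K₁ ∧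
            (∀ n, 0 ≤ (fam i).gammaVol n w) ∧ (fam i).gammaVol (fam i).K w ≤ S.vol ∧
            (∀ n, n < (fam i).K → n < jlogOf Cl (fam i).K → (fam i).gammaVol n w = 0) ∧
            (∀ n, n < (fam i).K → jlogOf Cl (fam i).K ≤ n → (fam i).gammaVol n w ≤ S.vol * Gv ^ ((fam i).K - n)) ∧
            |∑ X ∈ (L.fac K t τ).filter (fun X => ¬ dressed X) with R.u3.C.scale X = j,
                (R.u3.EA (g K) (uA K v) X - R.u3.EA (g K) L.oneA X)| ≤ |(fam i).eTerm j' (fam i).K w|) ∧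
          (∀ K t, |t| ≤ S.l₀ → ∀ τ ∈ S.T K \ S.Bad K t, ∀ v ∈ Rd.dom, ∀ j ≤ K, ∃ (i : I) (w : (fam i).Ω) (j' : ℕ),
            (fam i).flow.SatisfiesRG (fam i).K ∧ H033 (fam i).flow (fam i).K ∧ 1 ≤ j' ∧ j' ≤ (fam i).K ∧
            (fam i).K - j' = K - j ∧ (fam i).K ≤ K + K₁ ∧
            (∀ n, 0 ≤ (fam i).gammaVol n w) ∧ (fam i).gammaVol (fam i).K w ≤ S.vol ∧
            (∀ n, n < (fam i).K → n < jlogOf Cl (fam i).K → (fam i).gammaVol n w = 0) ∧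
            (∀ n, n < (fam i).K → jlogOf Cl (fam i).K ≤ n → (fam i).gammaVol n w ≤ S.vol * Gv ^ ((fam i).K - n)) ∧
            |∑ X ∈ (L.fac K t τ).filter (fun X => ¬ dressed X) with R.u3.C.scale X = j,
                (EB (fun i => g (K + 1) (i + 1)) (uB K v) X - EB (fun i => g (K + 1) (i + 1)) L.oneB X)|
              ≤ |(fam i).eTerm j' (fam i).K w|) ∧
          (∀ K t, |t| ≤ S.l₀ → ∀ τ ∈ S.T K \ S.Bad K t, ∀ v ∈ Rd.dom,
            ∃ (pA : R.ne1.P) (βA : R.u3.C.Dom → (R.ne1.𝒯.B pA K).Birth) (Q : Finset (R.ne1.𝒯.B pA K).Cube) (pB : R.ne1.P)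
              (KB : ℕ) (βB : R.u3.C.Dom → (R.ne1.𝒯.B pB KB).Birth),
            (∀ X ∈ (L.fac K t τ).filter (fun X => dressed X), (R.ne1.𝒯.B pA K).birthScale (βA X) = R.u3.C.scale X) ∧
            (∀ j, Set.InjOn βA ↑(((L.fac K t τ).filter (fun X => dressed X)).filter fun X => R.u3.C.scale X = j)) ∧
            (∀ c ∈ Q, (R.ne1.𝒯.B pA K).cubeScale c = K) ∧ ((Q.card : ℝ) ≤ S.vol) ∧
            (∀ X ∈ (L.fac K t τ).filter (fun X => dressed X), ∃ c ∈ Q, βA X ∈ (R.ne1.𝒯.B pA K).feltAt c) ∧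
            (∀ X ∈ (L.fac K t τ).filter (fun X => dressed X), KB - (R.ne1.𝒯.B pB KB).birthScale (βB X) = K - R.u3.C.scale X) ∧
            (∀ X ∈ (L.fac K t τ).filter (fun X => dressed X),
              |R.u3.EA (g K) (uA K v) X - R.u3.EA (g K) L.oneA X| ≤ (R.ne1.𝒯.B pA K).size (βA X) K) ∧
            (∀ X ∈ (L.fac K t τ).filter (fun X => dressed X),
              |EB (fun i => g (K + 1) (i + 1)) (uB K v) X - EB (fun i => g (K + 1) (i + 1)) L.oneB X|
                ≤ (R.ne1.𝒯.B pB KB).size (βB X) KB)) ∧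
          R.ne3.g = gradConst 4 c' ∧ 0 ≤ c' ∧ R.ne3.b ≤ t ∧ c' ≤ t ∧
          (2 : ℝ) ^ 91 * (R.ne3.L : ℝ) ^ 17 * t ≤ 1 ∧ (2 : ℝ) ^ 76 * (R.ne3.L : ℝ) ^ 12 * t ≤ R.ne3.ε ∧
          16 * B7Prop2Explicit.C0 4 * R.ne3.ε ≤ 3 ∧ 1024 * (4 + 1) * (4 + 4) * (R.ne3.L : ℝ) ^ 2 * R.ne3.ε ≤ 1 ∧
          4 * ((ℓ₃ F).ε / B F) ≤ c' ∧
          LeafH3sup 4 R.ne3.L R.ne3.Nper R.ne3.ε R.ne3.b c' R.ne3.dom ∧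
          (∀ V ∈ R.ne3.dom, ∀ k : ℕ, IsMinimiser 4 (sfClass 4 R.ne3.L R.ne3.Nper R.ne3.ε) R.ne3.L R.ne3.Nper k V (sel k V)) ∧
          (∀ V ∈ R.ne3.dom, ∀ k : ℕ, RegularSup 4 R.ne3.L R.ne3.Nper R.ne3.b c' k (sel k V)) ∧
          0 < θ ∧ θ ^ 6 = ((R.ne3.L : ℝ))⁻¹ ∧ 0 < γ₃ ∧
          R.ne3.C * (wallConst 4 R.ne3.L * (R.ne3.Nper : ℝ) ^ 2 *
            (Real.sqrt (gradConst 4 c') * dualC2 4 R.ne3.L + 2 * R.ne3.b ^ 2 * dualC1 4 R.ne3.L)) ≤ γ₃ ^ 3 ∧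
          0 < l₁ ∧ R.ne3.Λ₁ ≤ l₁ ^ 3 ∧ γ₃ * θ ^ 2 ≤ l₁ * R.ne3.Nper ∧ θ ^ ((3 : ℝ) * β - 2) ≤ θ₃ ∧ θ₃ < 1 ∧
          (∀ v ∈ Rd.dom, rd v ∈ R.ne3.dom) ∧
          (∀ k, ∀ v ∈ Rd.dom, Rd.act k v = minAct 4 (sfClass 4 R.ne3.L R.ne3.Nper R.ne3.ε) R.ne3.L R.ne3.Nper k (rd v)) ∧
          (R.ne3.Nper : ℝ) ^ 4 ≤ Rd.vol ∧ 1 ≤ k₀ ∧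
          (∀ K : ℕ, ∀ v ∈ Rd.dom, ∀ (u : B7Prop1Explicit.Site 4 → (Matrix (Fin N) (Fin N) ℂ)ˣ)
            (Z : B7Prop1Explicit.Site 4 → Fin 4 → Matrix (Fin N) (Fin N) ℂ) (M : ℝ),
            IsUnitarySite u → IsPeriodicSite u ((R.ne3.Nper * R.ne3.L ^ (k₀ + K) : ℕ) : ℤ) → T4AveragingDeficitWall.IsSkewDir Z →
            IsPeriodicDir Z ((R.ne3.Nper * R.ne3.L ^ (k₀ + K) : ℕ) : ℤ) →
            B7Prop1Explicit.gaugeAct u (sel (k₀ + K) (rd v)) =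
              T4AveragingDeficitWall.vary (B7Prop2Explicit.rescale R.ne3.L (B7Prop1Explicit.bavg R.ne3.L (sel (k₀ + K + 1) (rd v)))) Z 1 →
            (∀ (x : B7Prop1Explicit.Site 4) (κ : Fin 4), (R.ne3.L : ℝ) ^ (k₀ + K) * ‖Z x κ‖ ≤ M) →
            (∀ (x : B7Prop1Explicit.Site 4) (μ κ : Fin 4), ((R.ne3.L : ℝ) ^ (k₀ + K)) ^ 2 *
                ‖T4AveragingDeficitWall.Ad (B7Prop2Explicit.rescale R.ne3.L (B7Prop1Explicit.bavg R.ne3.L (sel (k₀ + K + 1) (rd v)))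
                    (x + B7Prop1Explicit.e κ) μ) (Z (x + B7Prop1Explicit.e μ) κ) - Z x κ‖ ≤ M) →
            R.u3.C.gauge (uA K v) (R.u3.C.transport (uB K v)) ≤ M) ∧
          R.u3.ρ ≤ θc ∧
          DecayBound R.u3.EA (Window γ) E₀T R.u3.κ ∧
          (∀ s ∈ Window γ, ∀ (X : R.u3.C.Dom) (U U' : R.u3.C.BgA),
            R.u3.C.gauge U U' < κ₁T * B14.alphaJ C₁T q₁ (s (R.u3.C.scale X)) →
            ∃ f : ℂ → ℂ, DifferentiableOn ℂ f (Metric.ball (0 : ℂ) (κ₁T * B14.alphaJ C₁T q₁ (s (R.u3.C.scale X)))) ∧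
              f 0 = (R.u3.EA s U X : ℂ) ∧ f (R.u3.C.gauge U U' : ℂ) = (R.u3.EA s U' X : ℂ) ∧
              ∀ z ∈ Metric.ball (0 : ℂ) (κ₁T * B14.alphaJ C₁T q₁ (s (R.u3.C.scale X))),
                ‖f z‖ ≤ E₀T * Real.exp (-(R.u3.κ * R.u3.C.d X))) ∧
          0 ≤ E₀T ∧ 0 < κ₁T ∧ 0 < C₁T ∧
          (∀ s ∈ Window γ, 0 < bsel s ∧ bsel s ≤ γ))
    (F : T4Family) (θ : Stage13HParams F N) (hP : θ.Provisos₁₃CoPH F N) (hRg : Rg F θ) (hθ : θ.Admissible F N) :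
    ForSmallCouplings (datumOfRecord₁₃CoPH F N θ hP) fun g₀ => StringwiseHybridNE7 ((datumOfRecord₁₃CoPH F N θ hP).scheme g₀) := by
  have hU := fun (F : T4Family) (θ : Stage13HParams F N) (hP : θ.Provisos₁₃CoPH F N) (hRg : Rg F θ) (hθ : θ.Admissible F N) =>
    u3KernelInputs_of_finiteVolumeLetters F N θ.toStage13Params (ℓ F θ) (hs F θ hP hRg hθ) (s F θ) (hr F θ hP hRg hθ) (hinc F θ hP hRg hθ) (hS F θ hP hRg hθ)
      (h9 F θ hP hRg hθ) (hW F θ hP hRg hθ)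
  exact bodyBFree₁₃CoPH_of_keyedFacesP_bFree (fun F θ hP g₀ os => crOfRecord₁₃VAt K₀ (jc F θ hP g₀ os) sh F θ hP g₀ os)
      (fun F θ hP g₀ os => rateCarriersOfRecord₁₃CoPH 𝔯 F θ hP g₀ os (ksel F θ hP g₀ os)) Rg
      (fun D R => RatesHolderAt D R β ∧ ReadOutAt D R.u3 ∧ (0 ≤ R.u3.ρ ∧ R.u3.ρ < 1))
      (fun F θ hP hRg hθ g₀ os => by
        obtain ⟨W, hW⟩ := h20 F θ hP hRg hθ g₀ os
        exact relWeightBound_crOfRecord₁₃VAt K₀ (jc F θ hP g₀ os) sh θ hP g₀ os hW)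
      (fun F θ hP hRg hθ g₀ os => by
        obtain ⟨Wsh, hWsh⟩ := h21 F θ hP hRg hθ g₀ os
        exact shellWeightBound_crOfRecord₁₃VAt K₀ (jc F θ hP g₀ os) sh θ hP g₀ os hWsh)
      (fun F θ hP hRg hθ => ForSmallCouplings.of_forall fun g₀ os =>
        pHolderD4Body_rateCarriers_of_kernels_pin 𝔯 θ hP g₀ os (ℓ F θ) (hpin F θ hP g₀ os) β (ksel F θ hP g₀ os)
          (n14At_rateCarriersOfRecord₁₃CoPH_of_pinned 𝔯 hpin1 F θ hP g₀ os (ksel F θ hP g₀ os))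
          (by
            obtain ⟨b, aS, ν, μ, α, β', c35, p, hb, haS, h⟩ := hpin2
            rw [h F θ hP g₀ os]
            exact n15At_fullGSizedObjects_family hb haS ν μ α β' c35 p F)
          (by
            show N16HolderAt (rateCarriersOfRecord₁₃CoPH 𝔯 F θ hP g₀ os (ksel F θ hP g₀ os)).ne3 β
            rw [rateCarriers_ne3_of_pinnedLoose hpinL F θ hP g₀ os (ksel F θ hP g₀ os)]
            exact h16 F ⟨θ, hP, hRg, hθ⟩)
          (hs F θ hP hRg hθ) (hκ F θ hP hRg hθ) (hcr F θ hP hRg hθ) (hρ F θ hP hRg hθ) (hU F θ hP hRg hθ).1 ((hU F θ hP hRg hθ).2.1 _)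
          ((hU F θ hP hRg hθ).2.2 _))
      (fun F θ hP hRg hθ => by
        obtain ⟨γ₀, b, b', hγ₀, hb0, hβ⟩ := hβw F θ hP hRg hθ
        obtain ⟨M, ρ₁, hM, hρ₁, hu⟩ := hunif F θ hP hRg hθ
        exact (forSmallCouplings_h19HolderD4_datumOfRecord₁₃CoPH_of_linkReadingAtN16PinnedReading
          (fun F θ hP g₀ os => crOfRecord₁₃VAt K₀ (jc F θ hP g₀ os) sh F θ hP g₀ os) 𝔯 (fun θ => Rg _ θ) hβ1 hlink hpinL hmatch hend F θ hP hRg hθ hγ₀ hb0 hβ hM hρ₁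
          hu).mono fun g₀ h os => h os (ksel F θ hP g₀ os))
      (fun F θ hP hRg hθ => by
        obtain ⟨E, hE⟩ := hsel F θ hP hRg hθ
        exact keyedExtraction_crOfRecord₁₃VAt_cut K₀ jc sh θ hP E hE (localBgMeasurable F N θ.ν) (hζm F θ hP hRg hθ) (zeta_nonneg_of_provisos₁₃CoPH F θ hP))
      F θ hP hRg hθ

end Summit.QuantumFields.YangMills.Theorems.BalabanUVNodesN27SpineRecord
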